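import Summits.Ventures.CertifiedQuantumChemistry.Rows.HubbardRingTVWeakCoupling
import Literature.MathematicalPhysics.QuantumChemistry.TwoElectronRelaxationExactness
import Literature.MathematicalPhysics.QuantumChemistry.TwoHoleRelaxationExactness
import HarnessLib

/-!
# Ventures/CertifiedQuantumChemistry — Rows/TwoElectronSectorsExact.lean: the level-DQG programme of the
# cell is EXACT in every two-electron and every two-hole sector of every symmetric model; on the TV-H
# rings this solves the `(1,1)` / `(L−1,L−1)` sectors and the whole DIMER `L = 2`, where the conjecture
# leaf's scaled gaps vanish identically (`n = 1`, outside S-U's range `n ≥ 2`)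

HONEST FRAMING (verbatim): certified bounds for a stated model Hamiltonian in a stated basis; not a
claim about the real molecule beyond that model.

Seat rdm-B, ROWS courtesy file (theorems only; no `def`, no notation, no instance; zero compute). The
Literature files `TwoElectronRelaxationExactness.lean` (Mazziotti 2007 §II.E.1: at `N = 2` the
`D`-condition is SUFFICIENT for `N`-representability, so `E_PQG(a, b) = E₀(Ĥ; a, b)` for `a + b = 2`) and
`TwoHoleRelaxationExactness.lean` (the particle–hole dual: `E_PQG(a, b) = E₀` for `a + b = 2|Λ| − 2`) are
stated for the generic `molecularHamiltonian h g h_nuc`; this file reads them on the cell's objects —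
`Model.pqgSectorEnergy F a b` (the level-DQG value, `Rows/ConjectureSU.lean`'s spelling) and `Model.energy
F a b` (the quantity K1 of `Statement.lean`) — complementing gen 38's `Rows/HubbardRingTVVacuumSector.lean`
(the ends `N = 0`, `N = 2L` of the filling range) with the next-to-ends `N = 2`, `N = 2L − 2`:

* §1 (every symmetric `F : Model k`) **`Model.pqgSectorEnergy_eq_energy_of_add_eq_two`** (`a + b = 2`,
  `a, b ≤ k`), **`Model.pqgSectorEnergy_eq_energy_twoHole`** (`a + b + 2 = 2k`), and the row reading
  `Model.pqgSectorEnergy_le_of_upperRow_two` (in a two-electron sector an UPPER row also bounds the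
  programme's value, so a certified `lo ≤ E_PQG` and an upper row bracket the PROGRAMME, not only `E₀`).
* §2 (the TV-H rings) `hubbardRingTV_pqgSectorEnergy_eq_energy_two` / `…_twoHole` (every `L, t, U`);
  **`hubbardRingTV_two_pqgSectorEnergy_eq_energy`** — THE HUBBARD DIMER (`L = 2`, the single bond `0 ~ 1`,
  half filling `(1, 1)`: two electrons = two holes) is solved exactly by level DQG for EVERY `t, U`;
  **`hubbardRingTV_two_pqgSingletEnergy_eq_energy`** — and by the singlet-restricted level for `U > 0`
  (squeeze `OPT_DQG ≤ OPT_DQG+S² ≤ E₀`, gen 38's `hubbardRingTV_pqgSingletEnergy_le_energy` = Lieb's bridge at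
  `L = 2·1`); **`hubbardRingTV_two_scaledGaps_eq_zero`** — in the conjecture leaf's own spelling
  (`hubbardRingTV (2·1) 1 U`, `U > 0`): `(U/4)·(E₀ − OPT_DQG) = 0` and `(U/4)·(E₀ − OPT_DQG+S²) = 0`
  identically — the `n = 1` boundary case, where S-U (stated for `n ≥ 2`) would read `c_X(2) = 0`;
  `hubbardRingTV_four_six_twoSectors_exact` — the quarter-filled 4-ring `(1,1)`, the two-electron 6-ring,
  and their two-hole partners `(3,3)` on `L = 4`, `(5,5)` on `L = 6` are exact at level DQG.

READING: statements about the VALUES of the abstract programmes on the cell's model objects; nothing here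
is a certificate, a row or a value of record, and nothing is claimed about the half-filled sectors
`(n, n)`, `n ≥ 2`, of S-U. All PROVED (0 sorry, standard axioms); no defs, no named facts. References
(docstring-only): D. A. Mazziotti, Adv. Chem. Phys. 134 (2007) ch. 3 §II.E.1–2; A. J. Coleman, Rev. Mod.
Phys. 35 (1963) 668; M. Nakata et al., J. Chem. Phys. 128 (2008) 164113 §II.C. Tree (REUSED):
`pqgSectorEnergy_eq_sectorGroundEnergy_of_add_eq_two`, `pqgSectorEnergy_eq_sectorGroundEnergy_twoHole`,
`pqgSectorEnergy_le_pqgSingletEnergy`, `hubbardRingTV_pqgSingletEnergy_le_energy` (gen 38),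
`Model.hamiltonian_isHermitian`, `hubbardRingTV_isSymmetric`.
-/

noncomputable section

namespace Summit.Ventures.CertifiedQuantumChemistry

open Matrix Finset
open Literature.MathematicalPhysics.QuantumLattice Literature.MathematicalPhysics.QuantumChemistry
open Summit.Ventures.CertifiedQuantumChemistry.Hamiltonians
open scoped ComplexOrder

/-! ## §1 Every symmetric model: the `D, Q, G` sector programme is EXACT in the two-electron and the
two-hole sectors -/

namespace Model

variable {k : ℕ} {F : Model k}

/-- **`E_PQG(a, b) = E₀(H_F; a, b)` FOR `a + b = 2`** (every symmetric model, `a, b ≤ k`): at two electrons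
the `D`-condition is already sufficient for `N`-representability (Mazziotti 2007 §II.E.1, the tree's
`pqgSectorEnergy_eq_sectorGroundEnergy_of_add_eq_two`), so the cell's level-DQG value IS the quantity K1.
[folklore] -/
theorem pqgSectorEnergy_eq_energy_of_add_eq_two (hF : F.IsSymmetric) {a b : ℕ} (hab : a + b = 2)
    (ha : a ≤ k) (hb : b ≤ k) : F.pqgSectorEnergy a b = F.energy a b :=
  pqgSectorEnergy_eq_sectorGroundEnergy_of_add_eq_two (F.hamiltonian_isHermitian hF) hab
    (by rw [Fintype.card_fin]; exact ha) (by rw [Fintype.card_fin]; exact hb)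

/-- **`E_PQG(a, b) = E₀(H_F; a, b)` FOR `a + b = 2k − 2`** (two holes; every symmetric model,
`a, b ≤ k`): the `Q`-condition is sufficient at `N = 2k − 2` (particle–hole duality, the tree's
`pqgSectorEnergy_eq_sectorGroundEnergy_twoHole`). [folklore] -/
theorem pqgSectorEnergy_eq_energy_twoHole (hF : F.IsSymmetric) {a b : ℕ} (hab : a + b + 2 = 2 * k)
    (ha : a ≤ k) (hb : b ≤ k) : F.pqgSectorEnergy a b = F.energy a b :=
  pqgSectorEnergy_eq_sectorGroundEnergy_twoHole (F.hamiltonian_isHermitian hF)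
    (by rw [Fintype.card_fin]; exact hab) (by rw [Fintype.card_fin]; exact ha) (by rw [Fintype.card_fin]; exact hb)

/-- Row reading: in a two-electron sector of a symmetric model an UPPER row bounds the relaxation value
from above as well — `E_PQG(a, b) ≤ hi` — so a certified lower bound `lo ≤ E_PQG` and an upper row make
a bracket of the PROGRAMME's value, not only of `E₀` (both values coincide). [folklore] -/
theorem pqgSectorEnergy_le_of_upperRow_two (hF : F.IsSymmetric) {a b : ℕ} (hab : a + b = 2) {hi : ℚ}
    (h : UpperRow F a b hi) : F.pqgSectorEnergy a b ≤ ((hi : ℚ) : ℝ) := by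
  rw [pqgSectorEnergy_eq_energy_of_add_eq_two hF hab h.1 h.2.1]
  exact h.le

end Model

/-! ## §2 The TV-H rings: two-electron and two-hole sectors of every ring, and the DIMER `L = 2` -/

section Ring

/-- **On every TV-H ring the level-DQG value is exact in the two-electron sectors**:
`OPT_DQG(L; t, U; a, b) = E₀(L; t, U; a, b)` for `(a, b) ∈ {(2,0), (1,1), (0,2)}`, `a, b ≤ L`. [folklore] -/
theorem hubbardRingTV_pqgSectorEnergy_eq_energy_two (L : ℕ) (t U : ℚ) {a b : ℕ} (hab : a + b = 2)
    (ha : a ≤ L) (hb : b ≤ L) :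
    Model.pqgSectorEnergy (hubbardRingTV L t U) a b = Model.energy (hubbardRingTV L t U) a b :=
  Model.pqgSectorEnergy_eq_energy_of_add_eq_two (hubbardRingTV_isSymmetric L t U) hab ha hb

/-- **… and in the two-hole sectors**: `OPT_DQG(L; t, U; a, b) = E₀(L; t, U; a, b)` for `a + b = 2L − 2`,
`a, b ≤ L`. [folklore] -/
theorem hubbardRingTV_pqgSectorEnergy_eq_energy_twoHole (L : ℕ) (t U : ℚ) {a b : ℕ}
    (hab : a + b + 2 = 2 * L) (ha : a ≤ L) (hb : b ≤ L) :
    Model.pqgSectorEnergy (hubbardRingTV L t U) a b = Model.energy (hubbardRingTV L t U) a b :=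
  Model.pqgSectorEnergy_eq_energy_twoHole (hubbardRingTV_isSymmetric L t U) hab ha hb

/-- **THE HUBBARD DIMER IS SOLVED EXACTLY BY THE LEVEL-DQG PROGRAMME**: on `hubbardRingTV 2 t U` (the
`L = 2` "ring" has the single bond `0 ~ 1`) at half filling, `OPT_DQG(2; t, U; 1, 1) = E₀(2; t, U; 1, 1)`
for EVERY `t` and `U` (two electrons = two holes here). [folklore] -/
theorem hubbardRingTV_two_pqgSectorEnergy_eq_energy (t U : ℚ) :
    Model.pqgSectorEnergy (hubbardRingTV 2 t U) 1 1 = Model.energy (hubbardRingTV 2 t U) 1 1 :=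
  hubbardRingTV_pqgSectorEnergy_eq_energy_two 2 t U rfl (by omega) (by omega)

/-- **… AND BY THE SINGLET-RESTRICTED PROGRAMME** (`U > 0`, every `t`):
`OPT_DQG+S²(2; t, U; 1) = E₀(2; t, U; 1, 1)` — squeezed between `OPT_DQG(1, 1)` (exact) and `E₀(1, 1)`
(gen 38's `hubbardRingTV_pqgSingletEnergy_le_energy`, Lieb's bridge on the even ring `L = 2·1`). [folklore] -/
theorem hubbardRingTV_two_pqgSingletEnergy_eq_energy (t : ℚ) {U : ℚ} (hU : 0 < U) :
    Model.pqgSingletEnergy (hubbardRingTV 2 t U) 1 = Model.energy (hubbardRingTV 2 t U) 1 1 := by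
  refine le_antisymm (hubbardRingTV_pqgSingletEnergy_le_energy (n := 1) le_rfl t hU) ?_
  rw [← hubbardRingTV_two_pqgSectorEnergy_eq_energy t U]
  exact pqgSectorEnergy_le_pqgSingletEnergy _ _ _ (by rw [Fintype.card_fin]; omega)

/-- **THE SCALED GAPS OF THE CONJECTURE LEAF VANISH IDENTICALLY ON THE DIMER** (the `n = 1` boundary case
of S-U's spelling, which quantifies `n ≥ 2`): for every rational `U > 0`,
`(U/4)·(E₀(2; 1, U; 1, 1) − OPT_DQG(2; 1, U; 1, 1)) = 0` and `(U/4)·(E₀(2; 1, U; 1, 1) − OPT_DQG+S²(2; 1, U; 1)) = 0`.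
[folklore] -/
theorem hubbardRingTV_two_scaledGaps_eq_zero {U : ℚ} (hU : 0 < U) :
    ((U : ℝ) / 4) * (Model.energy (hubbardRingTV (2 * 1) 1 U) 1 1 -
        Model.pqgSectorEnergy (hubbardRingTV (2 * 1) 1 U) 1 1) = 0 ∧
      ((U : ℝ) / 4) * (Model.energy (hubbardRingTV (2 * 1) 1 U) 1 1 -
        Model.pqgSingletEnergy (hubbardRingTV (2 * 1) 1 U) 1) = 0 := by
  rw [show 2 * 1 = 2 from rfl, hubbardRingTV_two_pqgSectorEnergy_eq_energy 1 U,
    hubbardRingTV_two_pqgSingletEnergy_eq_energy 1 hU, sub_self, mul_zero]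
  exact ⟨rfl, rfl⟩

/-- **The quarter-filled 4-ring and the two-electron 6-ring are solved exactly by level DQG**:
`OPT_DQG(4; t, U; 1, 1) = E₀(4; t, U; 1, 1)`, `OPT_DQG(6; t, U; 1, 1) = E₀(6; t, U; 1, 1)`; and by particle–
hole duality the `(3, 3)`-sector of the 4-ring and the `(5, 5)`-sector of the 6-ring likewise. [folklore] -/
theorem hubbardRingTV_four_six_twoSectors_exact (t U : ℚ) :
    Model.pqgSectorEnergy (hubbardRingTV 4 t U) 1 1 = Model.energy (hubbardRingTV 4 t U) 1 1 ∧
      Model.pqgSectorEnergy (hubbardRingTV 6 t U) 1 1 = Model.energy (hubbardRingTV 6 t U) 1 1 ∧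
      Model.pqgSectorEnergy (hubbardRingTV 4 t U) 3 3 = Model.energy (hubbardRingTV 4 t U) 3 3 ∧
      Model.pqgSectorEnergy (hubbardRingTV 6 t U) 5 5 = Model.energy (hubbardRingTV 6 t U) 5 5 :=
  ⟨hubbardRingTV_pqgSectorEnergy_eq_energy_two 4 t U rfl (by omega) (by omega),
    hubbardRingTV_pqgSectorEnergy_eq_energy_two 6 t U rfl (by omega) (by omega),
    hubbardRingTV_pqgSectorEnergy_eq_energy_twoHole 4 t U rfl (by omega) (by omega),
    hubbardRingTV_pqgSectorEnergy_eq_energy_twoHole 6 t U rfl (by omega) (by omega)⟩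

end Ring

end Summit.Ventures.CertifiedQuantumChemistry

end
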